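import Summits.BirchSwinnertonDyer.Rank1Residual.Additive.TypeGThreeTowerOfSurj
import Summits.BirchSwinnertonDyer.Rank1Residual.Additive.SubGordThree
import Summits.BirchSwinnertonDyer.Rank1Residual.Additive.GordIsogenyInvarianceClasses
import Summits.BirchSwinnertonDyer.Rank1Residual.GaloisImage.TameThreeAdicTowerKodaira
import HarnessLib

/-!
# The EXOTIC residue of class X4 at `p = 3` is WILD: with the tame tower (`I₀*`, `III`, `III*`) a
# theorem, an X4 pair at `3` with `ρ̄_{E,3}` onto whose `3`-adic tower fails has Kodaira type
# `II`, `IV`, `IV*` or `II*` at `3` (cell `b2b-bsdres`, team n1011, seat p14 gen 2 — OWNERS row T-b9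
# 'tame tower at 3', targets T3/T4 of `cells/n1011/skel/T-b9-tame-tower.md`; sequel of
# `Additive/TypeGThreeTowerOfSurj.lean` p251574 and `GaloisImage/TameThreeAdicTowerKodaira.lean`)

HONEST FRAMING (cell `b2b-bsdres`, run/shared/lean/b2b/bsd-rank1-residual/, verbatim in every
file): the goal of the cell is to DELETE the COMBINATION-SHAPED residual classes of the
Birch–Swinnerton-Dyer formula for ALL analytic-rank `≤ 1` elliptic curves over `ℚ` — "full BSD
formula for every rank `≤ 1` curve in class `C`" assembled STRICTLY from published theorems — so
that the rank-`≤ 1` remainder becomes exactly the CONSTRUCTION-SHAPED classes, which are TYPED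
(missing-input `Prop`s), NOT attempted. This is not "finishing BSD". Team n1011 (N10 / N11, the
additive block X4 ∧ `p = 3`): research route on the CONSTRUCTION-SHAPED class X4; no claim beyond the
stated classes; the label X4 is UNCHANGED by this file; nothing is booked. Theorems only (no
definition, no named fact minted; every published input of the end-state is an explicit named-fact
hypothesis, as in p250513 / p251574).

## What this file proves

For `W/ℚ` elliptic and globally minimal, write `K₃ := W.kodairaSymbolAt (placeOf 3)` (Tate's
algorithm at the place `(3)` of `ℤ`).

* §1 `typeG_three_of_kodairaSymbolAt_eq_Istar_zero` — `K₃ = I₀* ⟹ TypeG W 3` (the twist `E^{(−3)}`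
  is good at `3`: additive-p2's `hasGoodReductionAt_quadraticTwist_of_kodairaSymbolAt_eq_Istar_zero` +
  `typeG_of_hasGoodReductionAtPrime_quadraticTwist`); `padicValRat_j_neg_of_kodairaSymbolAt_eq_Istar_succ`
  — `K₃ = Iₙ*`, `n ≥ 1` ⟹ `ord₃ j < 0`.
* §2 **T3/T4.** `ClassX4.kodairaSymbolAt_wild_of_not_towerSurj_three` — an X4 pair at `3` with
  `ρ̄_{E,3}` onto whose tower `∀ n, ρ̄_{E,3ⁿ}` onto FAILS has `K₃ ∈ {II, IV, IV*, II*}`: the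
  symbol is additive (`isAdditive_kodairaSymbolAt_placeOf_of_addv`), `Iₙ*` (`n ≥ 1`) and `I₀*` are
  excluded by p251574 (`ClassX4.not_potMult_and_not_typeG_of_not_towerSurj_three`: potentially
  multiplicative and type-(G) rows have the tower), `III` and `III*` by the TAME TOWER
  (`GaloisImage.towerSurj_three_of_surj_of_kodairaSymbolAt_eq_III/_IIIstar`, this generation's T-b9);
  contrapositive `ClassX4.towerSurj_three_of_surj_of_kodairaSymbolAt_not_wild` — the tower from
  surj(3) on every X4 row at `3` of Kodaira type `Iₙ*` (`n ≥ 0`), `III` or `III*`, i.e. on every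
  TAME row (A. Kraus, Manuscripta Math. 69 (1990): at `3` the inertia of the semistabilising
  extension has order `2, 4, 4` on `I₀*, III, III*` and order divisible by `3` on `II, IV, IV*, II*`
  — the dictionary "tame ⟺ `{Iₙ*, III, III*}`" is CITED in this docstring, not used in a proof).
* §3 `exotic_iff_exotic_of_kodairaWild` and the END-STATE
  **`x4SharpUnitFree_iff_lower_and_residues_sharp_exoticWild_noL20`**: p251574's eight-fact
  end-state `x4SharpUnitFree_iff_lower_and_residues_sharp_exoticTypeG_noL20` with the EXOTIC piece
  (surj(3), `ord₃ j ≥ 0`, tower fails ⟹ upper half) now quantified ONLY over the rows with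
  `K₃ ∈ {II, IV, IV*, II*}` — the wild potentially supersingular rows (`v₃(N) ≥ 3`).  Elkies'
  `9`-deficient curves (the only known exotic ones) have `v₃(N) = 5`
  (`HOME/b2b-bsdres-n1011-p14/exotic/EXOTIC-SIGNATURE.md`, EVIDENCE).

Census reading (T-b1 engine 1, EVIDENCE): of the surj(3) X4@3 `r_an = 0` residue cells, the 7 346
Kodaira `III`/`III*` ones and all `I₀*` ones carry the tower as a theorem; the EXOTIC hypothesis of
the end-state now bears on wild cells only.  X4 stays CONSTRUCTION-SHAPED (the LOWER half is the
located gap); nothing booked; no label change.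

References: [Wuthrich2014] Lemma 20 (p. 399); [Kato2004Asterisque] (12.5.2) p. 222, Thm. 14.5 (3)
p. 236; [SilvermanATAEC1994] IV.9.4 and Table 4.1; A. Kraus, Manuscripta Math. 69 (1990) 353–385;
N. Elkies, *Elliptic curves with 3-adic Galois representation surjective mod 3 but not mod 9*,
arXiv:math/0612734.
-/

noncomputable section

open scoped Classical NumberField

open WeierstrassCurve IsDedekindDomain IsDedekindDomain.HeightOneSpectrum NumberField
  Rat.HeightOneSpectrum Literature.NumberTheory.EllipticCurves
  Literature.NumberTheory.EllipticCurves.ModularForms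
  Literature.NumberTheory.EllipticCurves.Rank1Residual
  Literature.NumberTheory.EllipticCurves.Rank1Residual.Typed
  Literature.NumberTheory.DiophantineGeometry
  Summit.BirchSwinnertonDyer.Rank1Residual.GaloisImage

namespace Summit.BirchSwinnertonDyer.Rank1Residual.Additive

/-! ### §1 The Kodaira symbol at the place `(3)` of `ℤ`: `I₀* ⟹ (G)`, `Iₙ* (n ≥ 1) ⟹ ord₃ j < 0` -/

section Dictionary

variable (W : WeierstrassCurve ℚ) [W.IsElliptic]

/-- The rational prime below `placeOf 3` is `3`. [folklore] -/
private theorem natGenerator_placeOf_three : natGenerator (placeOf 3) = 3 :=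
  Literature.NumberTheory.EllipticCurves.Rat.natGenerator_primesEquiv_symm ⟨3, Nat.prime_three⟩

/-- **Kodaira `I₀*` at `3` ⟹ Delbourgo type (G)**: the ramified twist `E^{(−3)}` has GOOD reduction
at `3` (Tate's algorithm Step 6 read backwards, additive-p2's
`hasGoodReductionAt_quadraticTwist_of_kodairaSymbolAt_eq_Istar_zero`), hence `E` acquires good
reduction over `ℚ(√−3) ⊆ ℚ(ζ₃)` (`typeG_of_hasGoodReductionAtPrime_quadraticTwist`).  The symbol is
read at the place `(3)` of `ℤ` and moved to the place of `𝓞 ℚ` by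
`GaloisImage.kodairaSymbolAt_primesEquiv_symm_three_eq`. [cite: SilvermanATAEC1994, IV.9.4 Step 6 (PDF p. 345)] -/
theorem typeG_three_of_kodairaSymbolAt_eq_Istar_zero
    (hK : W.kodairaSymbolAt (placeOf 3) = .Istar 0) : TypeG W 3 := by
  set u₃ : HeightOneSpectrum (𝓞 ℚ) := (primesEquiv (R := 𝓞 ℚ)).symm ⟨3, Nat.prime_three⟩
    with hu₃def
  have hu₃ : ((3 : ℕ) : 𝓞 ℚ) ∈ u₃.asIdeal :=
    (natCast_mem_asIdeal_iff_eq_primesEquiv_symm u₃ Nat.prime_three).mpr rfl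
  have hv3 : (primesEquiv u₃ : ℕ) = 3 := by rw [hu₃def, Equiv.apply_symm_apply]
  have hv2 : (primesEquiv u₃ : ℕ) ≠ 2 := by rw [hv3]; decide
  have hK' : W.kodairaSymbolAt u₃ = .Istar 0 := by
    rw [hu₃def, kodairaSymbolAt_primesEquiv_symm_three_eq (placeOf 3) W natGenerator_placeOf_three]
    exact hK
  have hgood := hasGoodReductionAt_quadraticTwist_of_kodairaSymbolAt_eq_Istar_zero u₃ W hv2
    (D := -3) (by rw [hv3]; norm_num) (by rw [hv3]; decide) hK'
  have hgood' :
      (W.quadraticTwist ((-1 : ℚ) ^ ((3 : ℕ) / 2) * (3 : ℕ))).HasGoodReductionAtPrime 3 := by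
    have h3 : ((-1 : ℚ) ^ ((3 : ℕ) / 2) * (3 : ℕ)) = ((-3 : ℤ) : ℚ) := by rw [pStar_three]; norm_num
    rw [h3]
    haveI : (W.quadraticTwist (((-3 : ℤ) : ℚ))).IsElliptic := W.isElliptic_quadraticTwist (by norm_num)
    exact hasGoodReductionAtPrime_of_hasGoodReductionAt _ u₃ hu₃ hgood
  exact typeG_of_hasGoodReductionAtPrime_quadraticTwist W 3 (by norm_num) hgood'

/-- **Kodaira `Iₙ*`, `n ≥ 1`, at `3` ⟹ `ord₃ j(E) < 0`** (potentially multiplicative; Silverman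
*ATAEC* IV Table 4.1, the tree's `one_lt_valuation_j_of_kodairaSymbolAt_eq_Istar_succ` read at the
place `(3)` of `ℤ` through `valuation_eq_exp_neg_padicValRat`).
[cite: SilvermanATAEC1994, IV Table 4.1 (PDF p. 365)] -/
theorem padicValRat_j_neg_of_kodairaSymbolAt_eq_Istar_succ {k : ℕ}
    (hK : W.kodairaSymbolAt (placeOf 3) = .Istar (k + 1)) : padicValRat 3 W.j < 0 := by
  have hchar : ringChar (ℤ ⧸ (placeOf 3).asIdeal) ≠ 2 := by
    rw [ringChar_int_quot_placeOf 3]; decide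
  have h1 := one_lt_valuation_j_of_kodairaSymbolAt_eq_Istar_succ (placeOf 3) W hchar hK
  have hj0 : W.j ≠ 0 := by
    intro h0
    rw [h0, map_zero] at h1
    exact not_lt.mpr zero_le_one h1
  rw [Rat.HeightOneSpectrum.valuation_eq_exp_neg_padicValRat (placeOf 3) hj0,
    natGenerator_placeOf_three, ← WithZero.exp_zero, WithZero.exp_lt_exp] at h1
  linarith

end Dictionary

/-! ### §2 T3/T4: the failing-tower rows of X4 at `3` are of Kodaira type `II`, `IV`, `IV*`, `II*` -/

section Wild

variable {W : WeierstrassCurve ℚ} [W.IsElliptic] [W.IsGloballyMinimal]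

/-- **T4. THE EXOTIC RESIDUE IS WILD.**  An X4 pair at `3` (`W` globally minimal, additive at `3`,
`ρ̄_{E,3}` irreducible) with `ρ̄_{E,3}` ONTO whose `3`-adic tower `∀ n, ρ̄_{E,3ⁿ}` onto FAILS has
Kodaira type `II`, `IV`, `IV*` or `II*` at `3`.  The additive symbol (`Addv`) is one of
`Iₙ*, II, III, IV, IV*, III*, II*`; `Iₙ*` with `n ≥ 1` is potentially multiplicative and `I₀*` is
type (G), both with the tower by p251574 (`ClassX4.not_potMult_and_not_typeG_of_not_towerSurj_three`);
`III`, `III*` have the tower by T-b9's tame tower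
(`towerSurj_three_of_surj_of_kodairaSymbolAt_eq_III/_IIIstar`).  By Kraus's classification at `3`
these four types are exactly the WILD potentially good ones (`3 ∣ #Φ`, `v₃(N) ≥ 3`); Elkies'
`9`-deficient curves have `v₃(N) = 5`. [cite: Wuthrich2014, Lemma 20 (p. 399)]
[cite: SilvermanATAEC1994, IV.9.4 and Table 4.1 (PDF p. 365)] [cite: SerreAbelianLadic1968, Ch. IV §3.4, Lemma 3 (IV-23)] -/
theorem ClassX4.kodairaSymbolAt_wild_of_not_towerSurj_three [Fact (Nat.Prime 3)]
    (hX : ClassX4 W 3) (hsurj : Surj W 3)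
    (hnot : ¬ ∀ n : ℕ, W.HasSurjectiveModNGaloisRep (3 ^ n : ℕ)) :
    W.kodairaSymbolAt (placeOf 3) = .II ∨ W.kodairaSymbolAt (placeOf 3) = .IV ∨
      W.kodairaSymbolAt (placeOf 3) = .IVstar ∨ W.kodairaSymbolAt (placeOf 3) = .IIstar := by
  obtain ⟨hj, hnG⟩ := ClassX4.not_potMult_and_not_typeG_of_not_towerSurj_three hX hsurj hnot
  have hk := isAdditive_kodairaSymbolAt_placeOf_of_addv W 3 hX.2.1
  rcases hks : W.kodairaSymbolAt (placeOf 3) with (_ | n) | _ | _ | _ | (_ | n) | _ | _ | _ <;>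
    rw [hks] at hk
  · exact absurd rfl hk.1
  · exact absurd ⟨_, Nat.succ_ne_zero _, rfl⟩ hk.2
  · exact Or.inl rfl
  · exact absurd (towerSurj_three_of_surj_of_kodairaSymbolAt_eq_III W (placeOf 3)
      natGenerator_placeOf_three hks hsurj) hnot
  · exact Or.inr (Or.inl rfl)
  · exact absurd (typeG_three_of_kodairaSymbolAt_eq_Istar_zero W hks) hnG
  · exact absurd (padicValRat_j_neg_of_kodairaSymbolAt_eq_Istar_succ W hks) hj
  · exact Or.inr (Or.inr (Or.inl rfl))
  · exact absurd (towerSurj_three_of_surj_of_kodairaSymbolAt_eq_IIIstar W (placeOf 3)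
      natGenerator_placeOf_three hks hsurj) hnot
  · exact Or.inr (Or.inr (Or.inr rfl))

/-- **T3. THE TOWER ON EVERY TAME ROW OF X4 AT `3`** (contrapositive of T4): an X4 pair at `3` with
`ρ̄_{E,3}` onto and Kodaira type NOT in `{II, IV, IV*, II*}` — i.e. `Iₙ*` (`n ≥ 0`: potentially
multiplicative, or `I₀*` = type (G)), `III` or `III*` — has `ρ̄_{E,3ⁿ}` onto for every `n`.  No
binder, no certificate: the census bit surj(3) alone. [cite: Wuthrich2014, Lemma 20 (p. 399)]
[cite: SerreAbelianLadic1968, Ch. IV §3.4, Lemma 3 (IV-23)] -/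
theorem ClassX4.towerSurj_three_of_surj_of_kodairaSymbolAt_not_wild [Fact (Nat.Prime 3)]
    (hX : ClassX4 W 3) (hsurj : Surj W 3)
    (hK : ¬ (W.kodairaSymbolAt (placeOf 3) = .II ∨ W.kodairaSymbolAt (placeOf 3) = .IV ∨
      W.kodairaSymbolAt (placeOf 3) = .IVstar ∨ W.kodairaSymbolAt (placeOf 3) = .IIstar))
    (n : ℕ) : W.HasSurjectiveModNGaloisRep (3 ^ n : ℕ) := by
  by_contra h
  exact hK (ClassX4.kodairaSymbolAt_wild_of_not_towerSurj_three hX hsurj fun hall ↦ h (hall n))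

/-- **Kato's (12.5.2) at `3` on every tame X4 row** (`Iₙ*`, `III`, `III*`) from surj(3).
[cite: Kato2004Asterisque, (12.5.2) (p. 222)] [cite: Wuthrich2014, Lemma 20 (p. 399)] -/
theorem ClassX4.imageContainsSL2_three_of_surj_of_kodairaSymbolAt_not_wild [Fact (Nat.Prime 3)]
    (hX : ClassX4 W 3) (hsurj : Surj W 3)
    (hK : ¬ (W.kodairaSymbolAt (placeOf 3) = .II ∨ W.kodairaSymbolAt (placeOf 3) = .IV ∨
      W.kodairaSymbolAt (placeOf 3) = .IVstar ∨ W.kodairaSymbolAt (placeOf 3) = .IIstar)) :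
    Kato2004.ImageContainsSL2 W 3 :=
  (Kato2004.imageContainsSL2_iff_forall_hasSurjectiveModNGaloisRep W 3).mpr
    (ClassX4.towerSurj_three_of_surj_of_kodairaSymbolAt_not_wild hX hsurj hK)

end Wild

/-! ### §3 The X4 end-state with the EXOTIC piece on the wild rows only -/

/-- **The EXOTIC hypothesis of the end-state, RESTRICTED to the wild Kodaira types.**  The EXOTIC
piece of p251574's end-state (`p = 3`, `r_an = 0`, X4, surj(3), `ord₃ j ≥ 0`, `¬ TypeG W 3`, tower
fails ⟹ upper half) is EQUIVALENT to the same statement on the rows whose Kodaira type at `3` is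
`II`, `IV`, `IV*` or `II*`: on every other row the premise "tower fails" contradicts §2, and on a
wild row with failing tower `¬ TypeG W 3` holds (`TypeG.towerSurj_three_of_surj`).
[cite: Wuthrich2014, Lemma 20 (p. 399)] [cite: SilvermanATAEC1994, IV.9.4 and Table 4.1 (PDF p. 365)] -/
theorem exotic_iff_exotic_of_kodairaWild :
    (∀ (W : WeierstrassCurve ℚ) [W.IsElliptic] [W.IsGloballyMinimal],
        W.analyticRank = 0 → ClassX4 W 3 → Surj W 3 → 0 ≤ padicValRat 3 W.j → ¬ TypeG W 3 →
        ¬ (∀ n : ℕ, W.HasSurjectiveModNGaloisRep (3 ^ n : ℕ)) → MissingUpperBoundAt W 3) ↔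
    (∀ (W : WeierstrassCurve ℚ) [W.IsElliptic] [W.IsGloballyMinimal],
        W.analyticRank = 0 → ClassX4 W 3 → Surj W 3 → 0 ≤ padicValRat 3 W.j →
        (W.kodairaSymbolAt (placeOf 3) = .II ∨ W.kodairaSymbolAt (placeOf 3) = .IV ∨
          W.kodairaSymbolAt (placeOf 3) = .IVstar ∨ W.kodairaSymbolAt (placeOf 3) = .IIstar) →
        ¬ (∀ n : ℕ, W.HasSurjectiveModNGaloisRep (3 ^ n : ℕ)) → MissingUpperBoundAt W 3) := by
  haveI : Fact (Nat.Prime 3) := ⟨Nat.prime_three⟩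
  constructor
  · intro h V _ _ hr hX hs hj _ hnot
    exact h V hr hX hs hj (fun hG ↦ hnot (TypeG.towerSurj_three_of_surj hG hX.2.1 hs)) hnot
  · intro h V _ _ hr hX hs hj _ hnot
    exact h V hr hX hs hj (ClassX4.kodairaSymbolAt_wild_of_not_towerSurj_three hX hs hnot) hnot

/-- **THE END-STATE OF CLASS X4 ON EIGHT NAMED FACTS with the EXOTIC piece on the WILD rows only:
X4♯(unit-free) ⟺ LOWER ∧ EXOTIC(`II/IV/IV*/II*` at `3`) ∧ TAM-DEFECT₂♭ ∧ ODD-SHA♭ ∧ MANIN♭** —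
`x4SharpUnitFree_iff_lower_and_residues_sharp_exoticTypeG_noL20` (p251574; binders `hCT`, `hKatoS`,
`hDel`, `hGZK`, `hmod`, `hmodD`, `hKatoχ`, `hK`) rewritten along `exotic_iff_exotic_of_kodairaWild`:
the EXOTIC residue (surj(3), `ord₃ j ≥ 0`, tower fails ⟹ upper half) is quantified over the rows of
Kodaira type `II`, `IV`, `IV*`, `II*` at `3` only — the wild potentially supersingular rows
(`v₃(N) ≥ 3`); no `I₀*`, `Iₙ*`, `III` or `III*` row of X4 at `3` is exotic.  No named fact beyond the
eight; X4 stays CONSTRUCTION-SHAPED; nothing booked.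
[cite: Kato2004Asterisque, Thm. 14.5 (3) (p. 236), Thm. 17.4 (3) (p. 273)] [cite: Delbourgo1998, Prop. 4 (p. 144)]
[cite: Wuthrich2014, Lemma 20 (p. 399)] [cite: SilvermanAEC2009, Thm. X.4.14]
[cite: Kim2022StructureSelmer, Conj. 1.10 (PDF p. 8)] [cite: Miller2011LMS, Def. 1.1] -/
theorem x4SharpUnitFree_iff_lower_and_residues_sharp_exoticWild_noL20
    (hCT : exists_casselsTate_pairing (K := ℚ))
    (hKatoS : Kato2004.rankZero_padicValNat_sha_le_sub_localTamagawa_of_additive_potGood_of_imageContainsSL2)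
    (hDel : Delbourgo1998.prop4_rankZero_pow_dvd_constantCoeff)
    (hGZK : rank_eq_analyticRank_of_analyticRank_le_one) (hmod : hasEntireLFunction_rat)
    (hmodD : nonempty_modularParametrizationData)
    (hKatoχ : Wuthrich2014.kato_halfEigenCharIdeal_dvd_cyclotomicPrime_of_surjective)
    (hK : Kato2004.charIdeal_dvd_padicLFunctionBranch_component_of_surjective) :
    X4SharpUnitFree ↔
      (∀ (W : WeierstrassCurve ℚ) [W.IsElliptic] [W.IsGloballyMinimal] (p : ℕ) [Fact p.Prime],
          W.analyticRank = 0 → ClassX4 W p → Surj W p → MissingLowerBoundAt W p) ∧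
      (∀ (W : WeierstrassCurve ℚ) [W.IsElliptic] [W.IsGloballyMinimal],
          W.analyticRank = 0 → ClassX4 W 3 → Surj W 3 → 0 ≤ padicValRat 3 W.j →
          (W.kodairaSymbolAt (placeOf 3) = .II ∨ W.kodairaSymbolAt (placeOf 3) = .IV ∨
            W.kodairaSymbolAt (placeOf 3) = .IVstar ∨ W.kodairaSymbolAt (placeOf 3) = .IIstar) →
          ¬ (∀ n : ℕ, W.HasSurjectiveModNGaloisRep (3 ^ n : ℕ)) → MissingUpperBoundAt W 3) ∧
      (∀ (W : WeierstrassCurve ℚ) [W.IsElliptic] [W.IsGloballyMinimal] (p : ℕ) [Fact p.Prime],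
          W.analyticRank = 0 → ClassX4 W p → Surj W p → 0 ≤ padicValRat p W.j →
          ¬ (TypeGOrd W p ∧ semistabilityIndex W p = 2) →
          padicValNat p ((W.baseChange ℚ_[p]).localTamagawaNumber ℤ_[p]) + 2 ≤
            padicValNat p W.tamagawaProduct →
          MissingUpperBoundAt W p) ∧
      (∀ (W : WeierstrassCurve ℚ) [W.IsElliptic] [W.IsGloballyMinimal] (p : ℕ) [Fact p.Prime],
          W.analyticRank = 0 → ClassX4 W p → Surj W p → 0 ≤ padicValRat p W.j →
          ¬ (TypeGOrd W p ∧ semistabilityIndex W p = 2) →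
          (∃ q : ℚ, shaAn W = (q : ℂ) ∧ Odd (padicValRat p q)) → MissingUpperBoundAt W p) ∧
      (∀ (W : WeierstrassCurve ℚ) [W.IsElliptic] [W.IsGloballyMinimal] (p : ℕ) [Fact p.Prime],
          W.analyticRank = 0 → ClassX4 W p → Surj W p → 0 ≤ padicValRat p W.j →
          ¬ (TypeGOrd W p ∧ semistabilityIndex W p = 2) →
          (∀ (N : ℕ) [NeZero N] (D : ModularParametrizationData W N), (p : ℤ) ∣ D.maninConstant) →
          MissingUpperBoundAt W p) := by
  rw [x4SharpUnitFree_iff_lower_and_residues_sharp_exoticTypeG_noL20 hCT hKatoS hDel hGZK hmod hmodD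
    hKatoχ hK, exotic_iff_exotic_of_kodairaWild]

end Summit.BirchSwinnertonDyer.Rank1Residual.Additive

end
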